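import Summits.QuantumFields.YangMills.Theorems.LuscherReductionTwistedTraceScalingBOGaugeAvgRiderLaplace
import HarnessLib

/-!
# (C1c'-θ) THE GAUGE-MODE CANCELLATION ALONG AN ORBIT: `|q(relLinkVec (U*^{P∘ξ})) − q(linkEmbed p.1)| ≤ (96t+b)·D'·(2‖x*‖ + D')`, `D' = C_L‖p‖‖ξ‖ + M‖ξ‖²` — valid for `‖ξ‖` up to the
# Taylor radius, NOT only on the `β^{-1}` Laplace core
# (lane A of S-BASE, crux `TwistedTraceScaling` stmt-QuantumFields-20203, C4-CORE, the (OD) pen; item (4'') of `pub/ym-fleet/ym-luscher-20007-p1/COARSE-DESIGN.md` §28.5)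

`…BOGaugeAvgRiderLaplace.rider_exp_core_bounds` controls the stiff rider along the based orbit of a slice tube point by the FULL displacement `‖basedLin p‖·‖ξ‖ + M‖ξ‖²`; that is enough on the
Laplace core `‖ξ‖ ≤ r = β^{-1}·polylog` but not for the slice→chart transfer (4'), where `‖ξ‖ = O(β^{-1/2}·polylog)`.  There the leading displacement `basedLin 0 ξ = −vacGrad ξ`
(`…SliceTaylorBased.basedLin_zero`) is a PURE GAUGE mode, invisible to `q` (`…StiffHessian.latCurl_gradient` + `…BOCentralChart.stiffGaussExp_add_of_ker`), and only the curvature of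
the slice chart `(basedLin p − basedLin 0)ξ = O(‖p‖‖ξ‖)` (`…SliceCoerciveBased.eventually_norm_basedLin_sub_le`, taken here as the hypothesis `hLip`) and the Taylor remainder `M‖ξ‖²` move `q`:
★★ `abs_stiffGaussExp_orbit_sub_le` and the exponential form ★ `rider_exp_orbit_bounds`.  With `‖p‖, ‖x*‖ = O(β^{-1/2}ℓ²)`, `‖ξ‖ = O(β^{-1/2}ℓ²)`: `(96t+b)·D'·‖x*‖ = O(β·β^{-1}ℓ⁴·β^{-1/2}ℓ²) → 0`.
HONEST FRAMING: one estimate for a stub of a child of the CONDITIONAL route R2b1; (C1c') (4'),(5),(rates), (C4), (C5), (B-ST) OPEN; C4-CORE OPEN; not infinite volume, not a gap, not Clay.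
-/

set_option autoImplicit false

noncomputable section

open MeasureTheory Real
open scoped BigOperators RealInnerProductSpace
open Literature.MathematicalPhysics.QuantumFieldTheory
open Literature.MathematicalPhysics.QuantumLattice

namespace Summit.QuantumFields.YangMills.Theorems.FemtoTransferGap.TwoLattice.ConstTube

open Summit.QuantumFields.YangMills.Theorems.FemtoTransferGap
open Summit.QuantumFields.YangMills.Theorems.FemtoTransferGap.TwoLattice.Avg
open Summit.QuantumFields.YangMills.Theorems.FemtoTransferGap.TwoLattice.Stiff
open Summit.QuantumFields.YangMills.Theorems.FemtoTransferGap.TwoLattice.GnChart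

variable {L : ℕ} [NeZero L]

/-- The vacuum gradient of any site function is a pure gauge, hence in the kernel of `t·H`. [folklore] -/
theorem smul_stiffHessian_vacGrad_eq_zero (t : ℝ) (φ : Site 3 L → Fin 3 → ℝ) : (t • stiffHessian L) (vacGrad L φ) = 0 := by
  have h : latCurl L (vacGrad L φ) = 0 := latCurl_gradient L φ
  rw [LinearMap.smul_apply, stiffHessian_eq_zero_of_latCurl L h, smul_zero]

/-- ★★ **Gauge-mode cancellation along the based orbit of a tube point.**  For `‖ξ‖ < ε_T`, `‖p‖ < ε_T`, `‖p‖ ≤ 1/40`, the Taylor datum `hT` and a Lipschitz bound `hLip` for `basedLin p − basedLin 0`: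
`|q_{t,b}(basedFn (ξ,p)) − q_{t,b}(linkEmbed p.1)| ≤ (96t+b)·D'·(2‖linkEmbed p.1‖ + D')`, `D' = C_L‖p‖‖ξ‖ + M‖ξ‖²` (`t,b ≥ 0`). [folklore] -/
theorem abs_stiffGaussExp_orbit_sub_le {t : ℝ} (ht : 0 ≤ t) {b : ℝ} (hb : 0 ≤ b) (p : balancedSubmodule L × (Fin 3 → Fin 3 → ℝ))
    {εT M : ℝ} (hM0 : 0 ≤ M)
    (hT : ∀ (ξ : basedSubmodule L) (q : balancedSubmodule L × (Fin 3 → Fin 3 → ℝ)), ‖ξ‖ < εT → ‖q‖ < εT →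
      ‖basedFn L (ξ, q) - basedFn L (0, q) - basedLin L q ξ‖ ≤ M * ‖ξ‖ ^ 2)
    {CL : ℝ} (hCL : 0 ≤ CL) (hLip : ∀ ξ : basedSubmodule L, ‖(basedLin L p - basedLin L 0) ξ‖ ≤ CL * ‖p‖ * ‖ξ‖)
    (hpT : ‖p‖ < εT) (hp40 : ‖p‖ ≤ 1 / 40) {ξ : basedSubmodule L} (hξ : ‖ξ‖ < εT) :
    let D' := CL * ‖p‖ * ‖ξ‖ + M * ‖ξ‖ ^ 2
    |stiffGaussExp L t b (basedFn L (ξ, p)) - stiffGaussExp L t b (linkEmbed L (p.1 : Edge 3 L → Fin 3 → ℝ))| ≤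
      (96 * t + b) * D' * (2 * ‖linkEmbed L (p.1 : Edge 3 L → Fin 3 → ℝ)‖ + D') := by
  intro D'
  set x' : LinkSpace L := linkEmbed L (p.1 : Edge 3 L → Fin 3 → ℝ) with hx'
  have hp1 : ‖p.1‖ ≤ 1 / 20 := (norm_fst_le p).trans (by linarith)
  have hp2 : ‖p.2‖ ≤ 1 / 40 := (norm_snd_le p).trans hp40
  have hfB0 : basedFn L (0, p) = x' := basedFn_zero_left L p hp1 hp2
  -- decomposition `fB(ξ,p) = (x' + rest) + (−vacGrad ξ)`
  set E : LinkSpace L := basedFn L (ξ, p) - x' - basedLin L p ξ with hE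
  set rest : LinkSpace L := (basedLin L p - basedLin L 0) ξ + E with hrest
  have hdec : basedFn L (ξ, p) = (x' + rest) + (-vacGrad L (ξ : Site 3 L → Fin 3 → ℝ)) := by
    have h1 : basedLin L p ξ = (basedLin L p - basedLin L 0) ξ + basedLin L 0 ξ := by rw [FunLike.coe_sub, Pi.sub_apply, sub_add_cancel]
    rw [hrest, hE, h1, basedLin_zero]; abel
  have hker : (t • stiffHessian L) (-vacGrad L (ξ : Site 3 L → Fin 3 → ℝ)) = 0 := by rw [map_neg, smul_stiffHessian_vacGrad_eq_zero, neg_zero]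
  have hq1 : stiffGaussExp L t b (basedFn L (ξ, p)) = stiffGaussExp L t b (x' + rest) := by rw [hdec, stiffGaussExp_add_of_ker b hker]
  -- size of `rest`
  have hEle : ‖E‖ ≤ M * ‖ξ‖ ^ 2 := by have h := hT ξ p hξ hpT; rw [hfB0] at h; exact h
  have hrest_le : ‖rest‖ ≤ D' := (norm_add_le _ _).trans (add_le_add (hLip ξ) hEle)
  have hD0 : 0 ≤ D' := (norm_nonneg _).trans hrest_le
  have hsum : ‖x' + rest + x'‖ ≤ 2 * ‖x'‖ + D' := by
    calc ‖x' + rest + x'‖ = ‖(x' + x') + rest‖ := by abel_nf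
      _ ≤ ‖x' + x'‖ + ‖rest‖ := norm_add_le _ _
      _ ≤ (‖x'‖ + ‖x'‖) + D' := add_le_add (norm_add_le _ _) hrest_le
      _ = 2 * ‖x'‖ + D' := by ring
  rw [hq1]
  calc _ ≤ (96 * t + b) * ‖x' + rest - x'‖ * ‖x' + rest + x'‖ := abs_stiffGaussExp_sub_le ht hb _ _
    _ = (96 * t + b) * ‖rest‖ * ‖x' + rest + x'‖ := by rw [add_sub_cancel_left]
    _ ≤ (96 * t + b) * D' * (2 * ‖x'‖ + D') := by gcongr

/-- ★ The exponential form: `e^{−q(x*)}e^{−ε'} ≤ e^{−q(relLinkVec (U*^{P∘ξ}))} ≤ e^{−q(x*)}e^{ε'}`, `ε' = (96t+b)D'(2‖x*‖+D')`, with `relLinkVec (U*^{P∘ξ}) = basedFn (ξ,p)` (`relLinkVec_gaugeTransform_tubePt`).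
[folklore] -/
theorem rider_exp_orbit_bounds {t : ℝ} (ht : 0 ≤ t) {b : ℝ} (hb : 0 ≤ b) (p : balancedSubmodule L × (Fin 3 → Fin 3 → ℝ))
    {εT M : ℝ} (hM0 : 0 ≤ M)
    (hT : ∀ (ξ : basedSubmodule L) (q : balancedSubmodule L × (Fin 3 → Fin 3 → ℝ)), ‖ξ‖ < εT → ‖q‖ < εT →
      ‖basedFn L (ξ, q) - basedFn L (0, q) - basedLin L q ξ‖ ≤ M * ‖ξ‖ ^ 2)
    {CL : ℝ} (hCL : 0 ≤ CL) (hLip : ∀ ξ : basedSubmodule L, ‖(basedLin L p - basedLin L 0) ξ‖ ≤ CL * ‖p‖ * ‖ξ‖)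
    (hpT : ‖p‖ < εT) (hp40 : ‖p‖ ≤ 1 / 40) {ξ : basedSubmodule L} (hξ : ‖ξ‖ < εT) :
    let D' := CL * ‖p‖ * ‖ξ‖ + M * ‖ξ‖ ^ 2
    let ε' := (96 * t + b) * D' * (2 * ‖linkEmbed L (p.1 : Edge 3 L → Fin 3 → ℝ)‖ + D')
    Real.exp (-stiffGaussExp L t b (linkEmbed L (p.1 : Edge 3 L → Fin 3 → ℝ))) * Real.exp (-ε') ≤
        Real.exp (-stiffGaussExp L t b (relLinkVec L (gaugeTransform (fun x => chartSU2 ((ξ : Site 3 L → Fin 3 → ℝ) x)) (tubePt L p)))) ∧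
      Real.exp (-stiffGaussExp L t b (relLinkVec L (gaugeTransform (fun x => chartSU2 ((ξ : Site 3 L → Fin 3 → ℝ) x)) (tubePt L p)))) ≤
        Real.exp (-stiffGaussExp L t b (linkEmbed L (p.1 : Edge 3 L → Fin 3 → ℝ))) * Real.exp ε' := by
  intro D' ε'
  have hq := abs_stiffGaussExp_orbit_sub_le ht hb p hM0 hT hCL hLip hpT hp40 hξ
  rw [relLinkVec_gaugeTransform_tubePt]
  refine ⟨?_, ?_⟩
  · rw [← Real.exp_add]; exact Real.exp_le_exp.2 (by linarith [(abs_le.1 hq).2])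
  · rw [← Real.exp_add]; exact Real.exp_le_exp.2 (by linarith [(abs_le.1 hq).1])

end Summit.QuantumFields.YangMills.Theorems.FemtoTransferGap.TwoLattice.ConstTube

end
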